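import Literature.Probability.Percolation.CutBlocksWindows
import Literature.Probability.Percolation.QuadLowestCrossingDefs
import HarnessLib

/-!
# The zones of a cut under the reflection and the transposition of the lattice

Topic `Probability/Percolation`.  Support file (proofs, no named fact) for the named fact
`SchrammSmirnov2011_thm_1_7` (zone geometry of the proof of Prop. 4.1, Ann. Probab. 39 (2011), §4):
the digitisation `CutBlocks.zones` is equivariant under the reflection `(x,y) ↦ (x,-y)` (cut
`conj α`, block `(z₁, -z₂-1)`, `Nset_reflect`, `Kset_reflect`, `collar_map_reflY`) and under the
transposition `(x,y) ↦ (y,x)` (the tree's `SSContinuity.swapC`; cut `swapC '' α`, block `(z₂, z₁)`, `Nset_swap`, `Kset_swap`,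
`collar_map_swap`), so the clean windows on flat stretches of the UPPER inner wall
(`cleanWindow_of_flatTop`) give clean windows on the lower wall (`FlatBottom`,
`cleanWindow_of_flatBottom`) and, after transposing, on the right and left walls; composites of
transports are single transports (`CollarDatum.map_map`).

## References

* O. Schramm, S. Smirnov, *On the scaling limits of planar percolation*, Ann. Probab. 39 (2011)
  1768–1814, arXiv:1101.5820, §4, proof of Prop. 4.1. [SchrammSmirnov2011]
-/

noncomputable section

open Set Metric
open Literature.Probability.LatticeModels
open scoped ComplexConjugate

namespace Literature.Probability.Percolation

/-! ### Composite transports of collar data -/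

/-- **Transporting twice is transporting by the composite.** [folklore] -/
theorem Seeded.CollarDatum.map_map (𝒞 : Seeded.CollarDatum) (ψ ψ' : Seeded.LatticeSym) :
    (𝒞.map ψ).map ψ' = 𝒞.map (ψ.trans ψ') := by
  simp only [Seeded.CollarDatum.map, Seeded.LatticeSym.trans, Finset.map_map, Set.image_image]
  congr 1

namespace CutBlocks

variable {s : ℝ} {α : Set ℂ} {δ : ℝ}

/-! ### Reflection -/

/-- The reflected block. [folklore] -/
theorem conj_mem_block_iff {w : ℂ} {z : ℤ × ℤ} : conj w ∈ block s (z.1, -z.2 - 1) ↔ w ∈ block s z := by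
  simp only [block, mem_setOf_eq, Complex.conj_re, Complex.conj_im]
  push_cast
  constructor
  · rintro ⟨h1, h2, h3, h4⟩; exact ⟨h1, h2, by linarith, by linarith⟩
  · rintro ⟨h1, h2, h3, h4⟩; exact ⟨h1, h2, by linarith, by linarith⟩

/-- The reflected neighbourhood. [folklore] -/
theorem conj_mem_thickening_iff {w : ℂ} {t : ℝ} : conj w ∈ thickening t (conj '' α) ↔ w ∈ thickening t α := by
  simp only [mem_thickening_iff, Set.exists_mem_image]
  refine exists_congr fun a => and_congr_right fun _ => ?_
  rw [Complex.dist_conj_conj]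

/-- **Tube blocks of the reflected cut.** [folklore] -/
theorem mem_tubeBlocks_reflect {z : ℤ × ℤ} : (z.1, -z.2 - 1) ∈ tubeBlocks s (conj '' α) ↔ z ∈ tubeBlocks s α := by
  constructor
  · rintro ⟨w, hwb, hwt⟩
    refine ⟨conj w, (conj_mem_block_iff (s := s) (w := conj w) (z := z)).1 (by simpa using hwb),
      (conj_mem_thickening_iff (α := α) (w := conj w) (t := s / 2)).1 (by simpa using hwt)⟩
  · rintro ⟨w, hwb, hwt⟩
    exact ⟨conj w, conj_mem_block_iff.2 hwb, conj_mem_thickening_iff.2 hwt⟩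

/-- **Ring blocks of the reflected cut.** [folklore] -/
theorem mem_ringBlocks_reflect {z : ℤ × ℤ} : (z.1, -z.2 - 1) ∈ ringBlocks s (conj '' α) ↔ z ∈ ringBlocks s α := by
  constructor
  · rintro ⟨hz, z', hz', h1, h2⟩
    refine ⟨fun h => hz (mem_tubeBlocks_reflect.2 h), (z'.1, -z'.2 - 1),
      (mem_tubeBlocks_reflect (α := α) (z := (z'.1, -z'.2 - 1))).1 (by simpa using hz'), by simpa using h1, ?_⟩
    simp only at h2 ⊢
    rw [abs_le] at h2 ⊢; constructor <;> linarith [h2.1, h2.2]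
  · rintro ⟨hz, z', hz', h1, h2⟩
    refine ⟨fun h => hz (mem_tubeBlocks_reflect.1 h), (z'.1, -z'.2 - 1), mem_tubeBlocks_reflect.2 hz', by simpa using h1, ?_⟩
    simp only
    rw [abs_le] at h2 ⊢; constructor <;> linarith [h2.1, h2.2]

/-- The mesh point of the reflected site. [folklore] -/
theorem meshPoint_reflYSite (δ : ℝ) (v : Site 2) : meshPoint δ (Seeded.LatticeSym.reflYSite v) = conj (meshPoint δ v) := by
  apply Complex.ext <;> simp [meshPoint_re, meshPoint_im]

/-- **Tube sites of the reflected cut.** [folklore] -/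
theorem mem_Nset_reflect {v : Site 2} : Seeded.LatticeSym.reflYSite v ∈ Nset s (conj '' α) δ ↔ v ∈ Nset s α δ := by
  simp only [Nset, mem_setOf_eq]
  rw [meshPoint_reflYSite]
  constructor
  · rintro ⟨b, hb, hvb⟩
    refine ⟨(b.1, -b.2 - 1), (mem_tubeBlocks_reflect (α := α) (z := (b.1, -b.2 - 1))).1 (by simpa using hb), ?_⟩
    rw [← conj_mem_block_iff]; simpa using hvb
  · rintro ⟨b, hb, hvb⟩
    exact ⟨(b.1, -b.2 - 1), mem_tubeBlocks_reflect.2 hb, conj_mem_block_iff.2 hvb⟩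

/-- **Collar sites of the reflected cut.** [folklore] -/
theorem mem_Kset_reflect {v : Site 2} : Seeded.LatticeSym.reflYSite v ∈ Kset s (conj '' α) δ ↔ v ∈ Kset s α δ := by
  rw [Kset, Kset, mem_sdiff, mem_sdiff, mem_Nset_reflect]
  refine and_congr_left fun _ => ?_
  simp only [mem_setOf_eq]
  rw [meshPoint_reflYSite]
  constructor
  · rintro ⟨b, hb, hvb⟩
    refine ⟨(b.1, -b.2 - 1), (mem_ringBlocks_reflect (α := α) (z := (b.1, -b.2 - 1))).1 (by simpa using hb), ?_⟩
    rw [← conj_mem_block_iff]; simpa using hvb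
  · rintro ⟨b, hb, hvb⟩
    exact ⟨(b.1, -b.2 - 1), mem_ringBlocks_reflect.2 hb, conj_mem_block_iff.2 hvb⟩

/-- The reflected cut is bounded. [folklore] -/
theorem isBounded_conj (hα : Bornology.IsBounded α) : Bornology.IsBounded (conj '' α) :=
  Complex.conjLIE.isometry.lipschitz.isBounded_image hα

/-- **The collar datum of the zones, reflected, is the collar datum of the zones of the reflected cut.** [folklore] -/
theorem collar_map_reflY (hs : 0 < s) (hδ : 0 < δ) (hα : Bornology.IsBounded α) :
    (zones hs hδ hα).collar.map Seeded.LatticeSym.reflY = (zones (α := conj '' α) hs hδ (isBounded_conj hα)).collar := by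
  have hK : ((zones hs hδ hα).collar.map Seeded.LatticeSym.reflY).K = (zones (α := conj '' α) hs hδ (isBounded_conj hα)).collar.K := by
    ext w
    obtain ⟨v, rfl⟩ : ∃ v, w = Seeded.LatticeSym.reflYSite v := ⟨Seeded.LatticeSym.reflYSite.symm w, by simp⟩
    rw [show Seeded.LatticeSym.reflYSite v = Seeded.LatticeSym.reflY.σ v from rfl, Seeded.CollarDatum.mem_map_K_iff]
    simp only [Seeded.Zones.collar_K, mem_zones_K]
    exact mem_Kset_reflect.symm
  have hF : ((zones hs hδ hα).collar.map Seeded.LatticeSym.reflY).Far = (zones (α := conj '' α) hs hδ (isBounded_conj hα)).collar.Far := by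
    ext w
    obtain ⟨v, rfl⟩ : ∃ v, w = Seeded.LatticeSym.reflYSite v := ⟨Seeded.LatticeSym.reflYSite.symm w, by simp⟩
    rw [show Seeded.LatticeSym.reflYSite v = Seeded.LatticeSym.reflY.σ v from rfl, Seeded.CollarDatum.mem_map_Far_iff]
    simp only [Seeded.Zones.collar_Far, Seeded.Zones.Far, mem_setOf_eq, mem_zones_K, mem_zones_N, zones_SQ,
      Finset.notMem_empty, not_false_eq_true, and_true]
    change _ ↔ Seeded.LatticeSym.reflYSite v ∉ _ ∧ Seeded.LatticeSym.reflYSite v ∉ _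
    rw [mem_Kset_reflect, mem_Nset_reflect]
  cases h : (zones hs hδ hα).collar.map Seeded.LatticeSym.reflY with
  | mk K F hd =>
    rw [h] at hK hF
    simp only at hK hF
    subst hK; subst hF
    rfl

/-- **A flat stretch of the lower inner wall**: three consecutive tube blocks whose lower
neighbours are not tube blocks. [folklore] -/
structure FlatBottom (s : ℝ) (α : Set ℂ) (z : ℤ × ℤ) : Prop where
  mid : z ∈ tubeBlocks s α
  left : (z.1 - 1, z.2) ∈ tubeBlocks s α
  right : (z.1 + 1, z.2) ∈ tubeBlocks s α
  down_mid : (z.1, z.2 - 1) ∉ tubeBlocks s α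
  down_left : (z.1 - 1, z.2 - 1) ∉ tubeBlocks s α
  down_right : (z.1 + 1, z.2 - 1) ∉ tubeBlocks s α

/-- A flat stretch of the lower wall is a flat stretch of the upper wall of the reflected cut. [folklore] -/
theorem FlatBottom.reflect {z : ℤ × ℤ} (h : FlatBottom s α z) : FlatTop s (conj '' α) (z.1, -z.2 - 1) where
  mid := mem_tubeBlocks_reflect.2 h.mid
  left := by
    have := mem_tubeBlocks_reflect (s := s) (α := α) (z := (z.1 - 1, z.2))
    simpa using this.2 h.left
  right := by
    have := mem_tubeBlocks_reflect (s := s) (α := α) (z := (z.1 + 1, z.2))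
    simpa using this.2 h.right
  up_mid := fun h' => h.down_mid (by
    have := mem_tubeBlocks_reflect (s := s) (α := α) (z := (z.1, z.2 - 1))
    rw [← this]; convert h' using 2; simp)
  up_left := fun h' => h.down_left (by
    have := mem_tubeBlocks_reflect (s := s) (α := α) (z := (z.1 - 1, z.2 - 1))
    rw [← this]; convert h' using 2; simp)
  up_right := fun h' => h.down_right (by
    have := mem_tubeBlocks_reflect (s := s) (α := α) (z := (z.1 + 1, z.2 - 1))
    rw [← this]; convert h' using 2; simp)

/-- **Clean straight windows on a flat stretch of the lower wall** (transported by the reflection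
followed by the down-shift of the reflected cut). [cite: SchrammSmirnov2011, §4, proof of Prop. 4.1] -/
theorem cleanWindow_of_flatBottom (hs : 0 < s) (hδ : 0 < δ) (hα : Bornology.IsBounded α) {z : ℤ × ℤ}
    (hz : FlatBottom s α z) {j : ℤ} {m R₁ : ℕ} (hcol₁ : s * (z.1 - 1) < δ * (j - R₁ - 2))
    (hcol₂ : δ * (j + m + R₁ + 2) < s * (z.1 + 2)) (h2δ : 2 * δ ≤ s) (hR₁ : δ * (R₁ + 4) ≤ s) :
    ((zones hs hδ hα).collar.map (Seeded.LatticeSym.reflY.trans (downShift s δ (-z.2 - 1)))).CleanWindow j m R₁ := by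
  rw [← Seeded.CollarDatum.map_map, collar_map_reflY]
  have := cleanWindow_of_flatTop hs hδ (isBounded_conj hα) hz.reflect (j := j) (m := m) (R₁ := R₁)
    (by simpa using hcol₁) (by simpa using hcol₂) h2δ hR₁
  simpa using this

/-! ### Transposition -/

open SSContinuity (swapC swapC_re swapC_im swapC_swapC)

/-- The transposition `swapC : x + iy ↦ y + ix` (from `QuadLowestCrossingDefs.lean`) is an isometry. [folklore] -/
theorem dist_swapC (x y : ℂ) : dist (swapC x) (swapC y) = dist x y := by
  rw [Complex.dist_eq, Complex.dist_eq, Complex.norm_eq_sqrt_sq_add_sq, Complex.norm_eq_sqrt_sq_add_sq]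
  simp only [Complex.sub_re, Complex.sub_im, swapC_re, swapC_im]
  rw [add_comm]

/-- The transposed block. [folklore] -/
theorem swapC_mem_block_iff {w : ℂ} {z : ℤ × ℤ} : swapC w ∈ block s (z.2, z.1) ↔ w ∈ block s z := by
  simp only [block, mem_setOf_eq, swapC_re, swapC_im]
  tauto

/-- The transposed neighbourhood. [folklore] -/
theorem swapC_mem_thickening_iff {w : ℂ} {t : ℝ} : swapC w ∈ thickening t (swapC '' α) ↔ w ∈ thickening t α := by
  simp only [mem_thickening_iff, Set.exists_mem_image]
  refine exists_congr fun a => and_congr_right fun _ => ?_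
  rw [dist_swapC]

/-- **Tube blocks of the transposed cut.** [folklore] -/
theorem mem_tubeBlocks_swap {z : ℤ × ℤ} : (z.2, z.1) ∈ tubeBlocks s (swapC '' α) ↔ z ∈ tubeBlocks s α := by
  constructor
  · rintro ⟨w, hwb, hwt⟩
    refine ⟨swapC w, (swapC_mem_block_iff (s := s) (w := swapC w) (z := z)).1 (by simpa using hwb),
      (swapC_mem_thickening_iff (α := α) (w := swapC w) (t := s / 2)).1 (by simpa using hwt)⟩
  · rintro ⟨w, hwb, hwt⟩
    exact ⟨swapC w, swapC_mem_block_iff.2 hwb, swapC_mem_thickening_iff.2 hwt⟩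

/-- **Ring blocks of the transposed cut.** [folklore] -/
theorem mem_ringBlocks_swap {z : ℤ × ℤ} : (z.2, z.1) ∈ ringBlocks s (swapC '' α) ↔ z ∈ ringBlocks s α := by
  constructor
  · rintro ⟨hz, z', hz', h1, h2⟩
    exact ⟨fun h => hz (mem_tubeBlocks_swap.2 h), (z'.2, z'.1),
      (mem_tubeBlocks_swap (α := α) (z := (z'.2, z'.1))).1 (by simpa using hz'), by simpa using h2, by simpa using h1⟩
  · rintro ⟨hz, z', hz', h1, h2⟩
    exact ⟨fun h => hz (mem_tubeBlocks_swap.1 h), (z'.2, z'.1), mem_tubeBlocks_swap.2 hz', by simpa using h2, by simpa using h1⟩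

/-- The mesh point of the transposed site. [folklore] -/
theorem meshPoint_swapSite (δ : ℝ) (v : Site 2) : meshPoint δ (Seeded.LatticeSym.swapSite v) = swapC (meshPoint δ v) := by
  apply Complex.ext <;> simp [meshPoint_re, meshPoint_im]

/-- **Tube sites of the transposed cut.** [folklore] -/
theorem mem_Nset_swap {v : Site 2} : Seeded.LatticeSym.swapSite v ∈ Nset s (swapC '' α) δ ↔ v ∈ Nset s α δ := by
  simp only [Nset, mem_setOf_eq]
  rw [meshPoint_swapSite]
  constructor
  · rintro ⟨b, hb, hvb⟩
    refine ⟨(b.2, b.1), (mem_tubeBlocks_swap (α := α) (z := (b.2, b.1))).1 (by simpa using hb), ?_⟩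
    rw [← swapC_mem_block_iff]; simpa using hvb
  · rintro ⟨b, hb, hvb⟩
    exact ⟨(b.2, b.1), mem_tubeBlocks_swap.2 hb, swapC_mem_block_iff.2 hvb⟩

/-- **Collar sites of the transposed cut.** [folklore] -/
theorem mem_Kset_swap {v : Site 2} : Seeded.LatticeSym.swapSite v ∈ Kset s (swapC '' α) δ ↔ v ∈ Kset s α δ := by
  rw [Kset, Kset, mem_sdiff, mem_sdiff, mem_Nset_swap]
  refine and_congr_left fun _ => ?_
  simp only [mem_setOf_eq]
  rw [meshPoint_swapSite]
  constructor
  · rintro ⟨b, hb, hvb⟩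
    refine ⟨(b.2, b.1), (mem_ringBlocks_swap (α := α) (z := (b.2, b.1))).1 (by simpa using hb), ?_⟩
    rw [← swapC_mem_block_iff]; simpa using hvb
  · rintro ⟨b, hb, hvb⟩
    exact ⟨(b.2, b.1), mem_ringBlocks_swap.2 hb, swapC_mem_block_iff.2 hvb⟩

/-- The transposed cut is bounded. [folklore] -/
theorem isBounded_swapC (hα : Bornology.IsBounded α) : Bornology.IsBounded (swapC '' α) := by
  have : Isometry swapC := Isometry.of_dist_eq dist_swapC
  exact this.lipschitz.isBounded_image hα

/-- **The collar datum of the zones, transposed, is the collar datum of the zones of the transposed cut.** [folklore] -/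
theorem collar_map_swap (hs : 0 < s) (hδ : 0 < δ) (hα : Bornology.IsBounded α) :
    (zones hs hδ hα).collar.map Seeded.LatticeSym.swap = (zones (α := swapC '' α) hs hδ (isBounded_swapC hα)).collar := by
  have hK : ((zones hs hδ hα).collar.map Seeded.LatticeSym.swap).K = (zones (α := swapC '' α) hs hδ (isBounded_swapC hα)).collar.K := by
    ext w
    obtain ⟨v, rfl⟩ : ∃ v, w = Seeded.LatticeSym.swapSite v := ⟨Seeded.LatticeSym.swapSite.symm w, by simp⟩
    rw [show Seeded.LatticeSym.swapSite v = Seeded.LatticeSym.swap.σ v from rfl, Seeded.CollarDatum.mem_map_K_iff]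
    simp only [Seeded.Zones.collar_K, mem_zones_K]
    exact mem_Kset_swap.symm
  have hF : ((zones hs hδ hα).collar.map Seeded.LatticeSym.swap).Far = (zones (α := swapC '' α) hs hδ (isBounded_swapC hα)).collar.Far := by
    ext w
    obtain ⟨v, rfl⟩ : ∃ v, w = Seeded.LatticeSym.swapSite v := ⟨Seeded.LatticeSym.swapSite.symm w, by simp⟩
    rw [show Seeded.LatticeSym.swapSite v = Seeded.LatticeSym.swap.σ v from rfl, Seeded.CollarDatum.mem_map_Far_iff]
    simp only [Seeded.Zones.collar_Far, Seeded.Zones.Far, mem_setOf_eq, mem_zones_K, mem_zones_N, zones_SQ,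
      Finset.notMem_empty, not_false_eq_true, and_true]
    change _ ↔ Seeded.LatticeSym.swapSite v ∉ _ ∧ Seeded.LatticeSym.swapSite v ∉ _
    rw [mem_Kset_swap, mem_Nset_swap]
  cases h : (zones hs hδ hα).collar.map Seeded.LatticeSym.swap with
  | mk K F hd =>
    rw [h] at hK hF
    simp only at hK hF
    subst hK; subst hF
    rfl

end CutBlocks

end Literature.Probability.Percolation

end
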